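import Summits.PneNP.PneNP.Theses.ExpanderLinearGenerators
import Literature.Computability.MetaComplexity.LinearMapResolutionWidthProofs
import Literature.Computability.MetaComplexity.ResolutionSizeWidth

/-!
# The resolution-SIZE rung under `LinearGeneratorDepthFregeHard` (route ExpanderLinearGenerators)

Helper file for item stmt-PneNP-11443
(`Summit.PneNP.PneNP.Theses.ExpanderLinearGenerators.LinearGeneratorDepthFregeHard`, Krajíček's
Problem 19.4.5 in universal-expander form, which asks the `2^{n^ε}` lower bound for bounded-depth
`textbookFrege`). This file proves the same statement ONE RUNG LOWER, for resolution, in the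
regime `0 < δ < 1/2` — Krajíček's Cor. 13.4.6 made uniform over all `(n^{1-δ}, 3/4·ℓ)`-boundary
expanders: every resolution refutation of `sumEncoding 1 E` has at least `2^{n^ε}` lines,
`ε = (1 - 2δ)/2`. Ingredients, all in the tree: the row-level Ben-Sasson–Wigderson width bound
(`not_resDerivable_empty_of_rows`: no refutation of width `< 3ℓr/8`) and the size–width relation
(`exp_le_length_of_not_derivable`, BSW Cor. 3.6), which give `|π| ≥ exp(t²/2n)` for
`t = ⌊r/16⌋`, `r = n^{1-δ} ≥ 32`, i.e. `exp(Ω(n^{1-2δ}))`. For `δ ≥ 1/2` the exponent `r²/n` is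
bounded and nothing follows — the resolution slice of the crux is itself not in print there.

References: J. Krajíček, *Proof Complexity* (CUP 2019), Lemma 13.4.5, Cor. 13.4.6;
E. Ben-Sasson, A. Wigderson, J. ACM 48 (2001), Thm 3.5, Cor. 3.6, Thm 6.5.
-/

namespace Summit.PneNP.PneNP.Theorems

set_option linter.dupNamespace false -- `Summit.PneNP.PneNP.…`: summit = sub-problem (D-0017)

open Literature.Computability.Complexity Literature.Computability.MetaComplexity

/-- The literals of `sumEncoding 1 E` are on variables `< n` (block `B = 1`). [folklore] -/
theorem fst_lt_of_mem_sumEncoding_one {n m : ℕ} (E : Fin m → LinEqMod 2 n) {c : Clause ℕ}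
    (hc : c ∈ sumEncoding 1 E) {l : Literal ℕ} (hl : l ∈ c) : l.1 < n := by
  simp only [sumEncoding, List.mem_flatMap, List.mem_finRange, true_and] at hc
  obtain ⟨k, hk⟩ := hc
  have hv := fst_mem_of_mem_canonicalCNF hk hl
  obtain ⟨i, -, hv⟩ := mem_eqVars.1 hv
  obtain ⟨j, hj, hv⟩ := mem_encBlock.1 hv
  rw [hv]
  have := i.2
  omega

/-- The clauses of `sumEncoding 1 E` for an `ℓ`-sparse system have at most `ℓ` literals.
[folklore] -/
theorem card_le_of_mem_clauseSet_sumEncoding_one {n m ℓ : ℕ} (E : Fin m → LinEqMod 2 n)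
    (hsparse : ∀ i, (E i).supp.card ≤ ℓ) {D : Finset (Literal ℕ)}
    (hD : D ∈ clauseSet (sumEncoding 1 E)) : D.card ≤ ℓ := by
  obtain ⟨c, hc, rfl⟩ := mem_clauseSet_iff.1 hD
  simp only [sumEncoding, List.mem_flatMap, List.mem_finRange, true_and] at hc
  obtain ⟨k, hk⟩ := hc
  calc c.toFinset.card ≤ c.length := List.toFinset_card_le _
    _ = (eqVars 1 (E k)).length := length_of_mem_canonicalCNF hk
    _ = (E k).supp.card * 1 := length_eqVars 1 (E k)
    _ ≤ ℓ := by rw [mul_one]; exact hsparse k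

/-- **Width into size** for the XOR-CNF of an `(r, 3/4·ℓ)`-boundary expander (`r ≥ 2`): if
`2t + ℓ < 3ℓr/8` and `t ≤ 2n`, every resolution refutation has at least `exp(t²/2n)` lines
(BSW Cor. 3.6 with `d = a = t`, `k = ℓ`, over the `n` variables, fed by the row-level width
bound). [BenSassonWigderson2001, Cor. 3.6, Thm 6.5] -/
theorem exp_le_length_of_expander {n m ℓ : ℕ} (E : Fin m → LinEqMod 2 n) {r : ℝ} (hℓ : 1 ≤ ℓ)
    (hsparse : ∀ i, (E i).supp.card ≤ ℓ)
    (hexp : IsBoundaryExpander (fun i => (E i).supp.map Fin.valEmbedding) r (3 / 4 * ℓ))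
    (hr : 2 ≤ r) {t : ℕ} (ht : 2 * (t : ℝ) + ℓ < 3 / 4 * ℓ * r / 2) (htn : t ≤ 2 * n)
    {π : List (ResLine ℕ)} (hπ : IsResRefutation (sumEncoding 1 E) π) :
    Real.exp ((t : ℝ) * t / (2 * n)) ≤ π.length := by
  have h1 : (1 : ℝ) ≤ ℓ := by exact_mod_cast hℓ
  have hc : (0 : ℝ) < 3 / 4 * ℓ := by linarith
  have hnd : ¬ ResDerivable (clauseSet (sumEncoding 1 E)) (t + t + ℓ) ∅ :=
    not_resDerivable_empty_of_rows E hexp hc hr (by push_cast; linarith)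
  have h := exp_le_length_of_not_derivable hπ (Finset.range n)
    (fun c hc l hl => Finset.mem_range.2 (fst_lt_of_mem_sumEncoding_one E hc hl))
    (fun D hD => card_le_of_mem_clauseSet_sumEncoding_one E hsparse hD) t
    (by rw [Finset.card_range]; exact htn) hnd
  rwa [Finset.card_range] at h

/-- Threshold arithmetic: `c ≤ n^e` once `n ≥ ⌈c^{1/e}⌉` (`c ≥ 0`, `e > 0`). [folklore] -/
theorem le_rpow_of_ceil_le {c e : ℝ} (hc : 0 ≤ c) (he : 0 < e) {n : ℕ}
    (hn : ⌈c ^ (1 / e)⌉₊ ≤ n) : c ≤ (n : ℝ) ^ e := by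
  have hy : c ^ (1 / e) ≤ n := (Nat.le_ceil _).trans (by exact_mod_cast hn)
  calc c = (c ^ (1 / e)) ^ e := by
        rw [← Real.rpow_mul hc, one_div, inv_mul_cancel₀ he.ne', Real.rpow_one]
    _ ≤ (n : ℝ) ^ e := Real.rpow_le_rpow (Real.rpow_nonneg hc _) hy he.le

/-- **The resolution-size rung for `δ < 1/2`** (Krajíček 2019 Cor. 13.4.6, uniform over
expanders): for `ℓ ≥ 1` and `0 < δ < 1/2` there are `ε > 0` (namely `(1 - 2δ)/2`) and `N` such that
for `n ≥ N`, every `ℓ`-sparse system `E` over `𝔽₂` in `n` unknowns whose row supports form an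
`(n^{1-δ}, 3/4·ℓ)`-boundary expander and which is unsolvable admits no resolution refutation of
`sumEncoding 1 E` with fewer than `2^{n^ε}` lines. (Unsolvability is not used; it only makes
refutations exist.) This is the statement of `LinearGeneratorDepthFregeHard` (stmt-PneNP-11443)
with bounded-depth `textbookFrege` replaced by resolution and `δ < 1/2`.
[KrajicekProofComplexity2019, Cor. 13.4.6; BenSassonWigderson2001, Cor. 3.6, Thm 6.5] -/
theorem linearGenerator_resolution_size_lower_bound :
    ∀ (ℓ : ℕ) (δ : ℝ), 1 ≤ ℓ → 0 < δ → δ < 1 / 2 → ∃ ε : ℝ, 0 < ε ∧ ∃ N : ℕ, ∀ n : ℕ, N ≤ n →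
      ∀ (m : ℕ) (E : Fin m → Literature.Computability.MetaComplexity.LinEqMod 2 n),
        (∀ i, (E i).supp.card ≤ ℓ) →
        Literature.Computability.MetaComplexity.IsBoundaryExpander
          (fun i => (E i).supp.map Fin.valEmbedding) ((n : ℝ) ^ (1 - δ)) (3 / 4 * ℓ) →
        ¬ Literature.Computability.MetaComplexity.SystemSat E Finset.univ →
        ∀ π : List (Literature.Computability.MetaComplexity.ResLine ℕ),
          Literature.Computability.MetaComplexity.IsResRefutation
            (Literature.Computability.MetaComplexity.sumEncoding 1 E) π →
          (2 : ℝ) ^ ((n : ℝ) ^ ε) ≤ (π.length : ℝ) := by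
  intro ℓ δ hℓ hδ hδ2
  set ε : ℝ := (1 - 2 * δ) / 2 with hε
  have hεpos : 0 < ε := by rw [hε]; linarith
  have h1δ : 0 < 1 - δ := by linarith
  refine ⟨ε, hεpos, ⌈(2048 : ℝ) ^ (1 / ε)⌉₊ + ⌈(32 : ℝ) ^ (1 / (1 - δ))⌉₊,
    fun n hn m E hsparse hexp _ π hπ => ?_⟩
  -- the two thresholds
  have hy : (2048 : ℝ) ≤ (n : ℝ) ^ ε := le_rpow_of_ceil_le (by norm_num) hεpos (by omega)
  have hr : (32 : ℝ) ≤ (n : ℝ) ^ (1 - δ) := le_rpow_of_ceil_le (by norm_num) h1δ (by omega)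
  have hn1 : (1 : ℝ) ≤ n := by
    rcases Nat.eq_zero_or_pos n with h0 | h0
    · exfalso
      rw [h0, Nat.cast_zero, Real.zero_rpow h1δ.ne'] at hr
      linarith
    · exact_mod_cast h0
  have hnpos : (0 : ℝ) < n := by linarith
  set r : ℝ := (n : ℝ) ^ (1 - δ) with hrdef
  set y : ℝ := (n : ℝ) ^ ε with hydef
  have hℓ1 : (1 : ℝ) ≤ ℓ := by exact_mod_cast hℓ
  -- `r ≤ n`
  have hrn : r ≤ n := by
    rw [hrdef]
    calc (n : ℝ) ^ (1 - δ) ≤ (n : ℝ) ^ (1 : ℝ) :=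
          Real.rpow_le_rpow_of_exponent_le hn1 (by linarith)
      _ = n := Real.rpow_one _
  -- the width parameter `t = ⌊r/16⌋`
  set t : ℕ := ⌊r / 16⌋₊ with htdef
  have ht_le : (t : ℝ) ≤ r / 16 := Nat.floor_le (by positivity)
  have ht_ge : r / 32 ≤ t := by
    have := Nat.lt_floor_add_one (r / 16)
    rw [← htdef] at this
    linarith
  have ht : 2 * (t : ℝ) + ℓ < 3 / 4 * ℓ * r / 2 := by nlinarith
  have htn : t ≤ 2 * n := by
    have : (t : ℝ) ≤ 2 * n := by linarith
    exact_mod_cast this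
  have hmain := exp_le_length_of_expander E hℓ hsparse hexp (by linarith) ht htn hπ
  -- `r² = n · y²`
  have hr2 : r ^ 2 = n * y ^ 2 := by
    rw [hrdef, hydef, ← Real.rpow_natCast, ← Real.rpow_mul hnpos.le, ← Real.rpow_natCast,
      ← Real.rpow_mul hnpos.le, ← Real.rpow_one_add' hnpos.le (by rw [hε]; push_cast; linarith)]
    congr 1
    rw [hε]; push_cast; ring
  -- `y ≤ t²/2n`
  have hkey : y ≤ (t : ℝ) * t / (2 * n) := by
    rw [le_div_iff₀ (by positivity)]
    have h1 : r ^ 2 / 1024 ≤ (t : ℝ) * t := by nlinarith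
    have h2 : y * (2 * n) * 1024 ≤ n * y ^ 2 := by nlinarith
    nlinarith
  -- `2^y ≤ exp y ≤ exp (t²/2n) ≤ |π|`
  have h2y : (2 : ℝ) ^ y ≤ Real.exp y := by
    rw [Real.rpow_def_of_pos (by norm_num)]
    refine Real.exp_le_exp.2 ?_
    have hlog : Real.log 2 ≤ 1 := by
      have := Real.log_two_lt_d9; linarith
    have hy0 : 0 ≤ y := by linarith
    nlinarith
  exact h2y.trans ((Real.exp_le_exp.2 hkey).trans hmain)

end Summit.PneNP.PneNP.Theorems
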